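import Mathlib
import Summits.KontsevichZagierPeriods.KontsevichZagierPeriods.Theorems.SoloInformedShuffleProduct
import Summits.KontsevichZagierPeriods.KontsevichZagierPeriods.Theorems.SoloInformedShuffleFill
import HarnessLib
import HarnessLib.Audit

/-!
# SoloInformed — linear extensions of two chains are colourings (PROGRAMME XLII, file 2)

Solo programme `solo-KontsevichZagierPeriods-informed`, session s47. Dimension
`n = (p + 2) + (q + 2)`; `E = soloInformedShPoset p q` is the union of the chain
`t₀ > ⋯ > t_{p+1}` on the first block and the chain `t_{p+2} > ⋯ > t_{n−1}` on the second block
(file `SoloInformedShuffleChains`).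

A permutation `σ` is a linear extension of `E` iff its slot map `P_σ = rev ∘ σ⁻¹`
(`soloInformedCellPerm σ`) is increasing on each block (`soloInformed_shCompat_iff`). Colour the slot
`k` by the block of the coordinate it carries (`soloInformedShColour σ`): this is a bijection

  `{linear extensions of E} ≃ {c : Fin n → Bool | #c⁻¹(true) = p + 2}`

(inverse `soloInformedColSigma`: the `i`-th coordinate of the first block goes to the `i`-th `true`
slot, via `Finset.orderEmbOfFin`), and — the point of the file — reading the letters of the product
word `ε = bw(s) ++ bw(t)` in slot order gives exactly the interleaving `fill_c(bw(s), bw(t))` of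
file 1 (`soloInformed_shWord_eq_fillC`). Consequently sums over linear extensions are sums over
colourings (`soloInformed_sum_shCompat_eq_sum_colouring`), which file 3 matches with LEMMA SW.

References: Stanley 1986, *Two poset polytopes*, §1; Reutenauer 1993 §1.4;
Kontsevich–Zagier 2001 §1.2 [KontsevichZagier2001].
-/

noncomputable section

open Literature.NumberTheory.Transcendental
open Literature.NumberTheory.Transcendental.KZ

namespace Summit.KontsevichZagierPeriods.KontsevichZagierPeriods.Theorems

variable {p q : ℕ}

/-! ## 1. Linear extensions of two chains = pairs of increasing slot maps -/

/-- `σ⁻¹ = rev ∘ P_σ`. -/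
theorem soloInformed_symm_apply_eq_rev_cellPerm {n : ℕ} (σ : Equiv.Perm (Fin n)) (x : Fin n) :
    σ.symm x = Fin.rev (soloInformedCellPerm σ x) := by
  simp [soloInformedCellPerm]

/-- `σ = rev-conjugate of the inverse slot map`. -/
theorem soloInformed_eq_revPerm_trans_cellPerm_symm {n : ℕ} (σ : Equiv.Perm (Fin n)) :
    σ = Fin.revPerm.trans (soloInformedCellPerm σ).symm := by
  refine Equiv.ext fun x => ?_
  simp [soloInformedCellPerm]

/-- **A permutation is a linear extension of the two chains iff its slot map is increasing on
each block.** -/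
theorem soloInformed_shCompat_iff {σ : Equiv.Perm (Fin (p + 2 + (q + 2)))} :
    soloInformedCompat (soloInformedShPoset p q) σ ↔
      StrictMono (fun i : Fin (p + 2) => soloInformedCellPerm σ (Fin.castAdd (q + 2) i)) ∧
        StrictMono (fun j : Fin (q + 2) => soloInformedCellPerm σ (Fin.natAdd (p + 2) j)) := by
  constructor
  · intro hσ
    refine ⟨Fin.strictMono_iff_lt_succ.2 fun i => ?_, Fin.strictMono_iff_lt_succ.2 fun j => ?_⟩
    · have h := soloInformed_shCompat_left hσ i
      rw [soloInformed_symm_apply_eq_rev_cellPerm, soloInformed_symm_apply_eq_rev_cellPerm,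
        Fin.rev_lt_rev] at h
      exact h
    · have h := soloInformed_shCompat_right hσ j
      rw [soloInformed_symm_apply_eq_rev_cellPerm, soloInformed_symm_apply_eq_rev_cellPerm,
        Fin.rev_lt_rev] at h
      exact h
  · rintro ⟨h1, h2⟩ c hc
    unfold soloInformedShPoset at hc
    rcases List.mem_append.1 hc with hc | hc
    · obtain ⟨i, -, rfl⟩ := List.mem_map.1 hc
      rw [soloInformed_symm_apply_eq_rev_cellPerm, soloInformed_symm_apply_eq_rev_cellPerm,
        Fin.rev_lt_rev]
      exact h1 (Fin.castSucc_lt_succ (i := i))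
    · obtain ⟨j, -, rfl⟩ := List.mem_map.1 hc
      rw [soloInformed_symm_apply_eq_rev_cellPerm, soloInformed_symm_apply_eq_rev_cellPerm,
        Fin.rev_lt_rev]
      exact h2 (Fin.castSucc_lt_succ (i := j))

/-! ## 2. The colouring of a linear extension -/

/-- The slot colouring of `σ`: slot `k` is `true` iff it carries a coordinate of the first block. -/
def soloInformedShColour (σ : Equiv.Perm (Fin (p + 2 + (q + 2)))) (k : Fin (p + 2 + (q + 2))) :
    Bool :=
  decide ((((soloInformedCellPerm σ).symm k : Fin (p + 2 + (q + 2))) : ℕ) < p + 2)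

/-- Slots of first-block coordinates are `true`. -/
theorem soloInformed_shColour_cellPerm_castAdd (σ : Equiv.Perm (Fin (p + 2 + (q + 2))))
    (i : Fin (p + 2)) :
    soloInformedShColour σ (soloInformedCellPerm σ (Fin.castAdd (q + 2) i)) = true := by
  simp [soloInformedShColour]

/-- Slots of second-block coordinates are `false`. -/
theorem soloInformed_shColour_cellPerm_natAdd (σ : Equiv.Perm (Fin (p + 2 + (q + 2))))
    (j : Fin (q + 2)) :
    soloInformedShColour σ (soloInformedCellPerm σ (Fin.natAdd (p + 2) j)) = false := by
  simp [soloInformedShColour]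

/-- The `true` slots are exactly the slots of the first block. -/
theorem soloInformed_shColour_eq_true_iff (σ : Equiv.Perm (Fin (p + 2 + (q + 2))))
    (k : Fin (p + 2 + (q + 2))) :
    soloInformedShColour σ k = true ↔
      ∃ i : Fin (p + 2), k = soloInformedCellPerm σ (Fin.castAdd (q + 2) i) := by
  constructor
  · intro h
    obtain ⟨x, rfl⟩ : ∃ x, k = soloInformedCellPerm σ x :=
      ⟨(soloInformedCellPerm σ).symm k, ((soloInformedCellPerm σ).apply_symm_apply k).symm⟩
    induction x using Fin.addCases with
    | left i => exact ⟨i, rfl⟩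
    | right j =>
      rw [soloInformed_shColour_cellPerm_natAdd] at h
      exact absurd h Bool.false_ne_true
  · rintro ⟨i, rfl⟩
    exact soloInformed_shColour_cellPerm_castAdd σ i

/-- The `false` slots are exactly the slots of the second block. -/
theorem soloInformed_shColour_eq_false_iff (σ : Equiv.Perm (Fin (p + 2 + (q + 2))))
    (k : Fin (p + 2 + (q + 2))) :
    soloInformedShColour σ k = false ↔
      ∃ j : Fin (q + 2), k = soloInformedCellPerm σ (Fin.natAdd (p + 2) j) := by
  constructor
  · intro h
    obtain ⟨x, rfl⟩ : ∃ x, k = soloInformedCellPerm σ x :=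
      ⟨(soloInformedCellPerm σ).symm k, ((soloInformedCellPerm σ).apply_symm_apply k).symm⟩
    induction x using Fin.addCases with
    | left i =>
      rw [soloInformed_shColour_cellPerm_castAdd] at h
      exact absurd h.symm Bool.false_ne_true
    | right j => exact ⟨j, rfl⟩
  · rintro ⟨j, rfl⟩
    exact soloInformed_shColour_cellPerm_natAdd σ j

/-- Exactly `p + 2` slots are `true`. -/
theorem soloInformed_countC_shColour (σ : Equiv.Perm (Fin (p + 2 + (q + 2)))) :
    soloInformedCountC (soloInformedShColour σ) = p + 2 := by
  unfold soloInformedCountC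
  have h : (Finset.univ.filter fun k => soloInformedShColour σ k = true) =
      Finset.univ.image fun i : Fin (p + 2) => soloInformedCellPerm σ (Fin.castAdd (q + 2) i) := by
    ext k
    simp only [Finset.mem_filter, Finset.mem_univ, true_and, Finset.mem_image,
      soloInformed_shColour_eq_true_iff]
    constructor
    · rintro ⟨i, hi⟩
      exact ⟨i, hi.symm⟩
    · rintro ⟨i, hi⟩
      exact ⟨i, hi.symm⟩
  have hinj : Function.Injective fun i : Fin (p + 2) =>
      soloInformedCellPerm σ (Fin.castAdd (q + 2) i) := fun i j hij =>
    Fin.ext (by simpa using congrArg Fin.val ((soloInformedCellPerm σ).injective hij))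
  rw [h, Finset.card_image_of_injective _ hinj, Finset.card_univ, Fintype.card_fin]

/-! ## 3. The word of a piece read in slot order is the interleaving of the colouring -/

/-- Along an increasing enumeration `f` of the `true` positions, the `u`-index of `f i` is `i`. -/
theorem soloInformed_idxC_of_strictMono {n m : ℕ} (c : Fin n → Bool) {f : Fin m → Fin n}
    (hf : StrictMono f) (hc : ∀ k, c k = true ↔ ∃ i, k = f i) (i : Fin m) :
    soloInformedIdxC c (f i) = i := by
  unfold soloInformedIdxC
  have h : (Finset.univ.filter fun j : Fin n => j < f i ∧ c j = true) = (Finset.Iio i).image f := by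
    ext k
    simp only [Finset.mem_filter, Finset.mem_univ, true_and, Finset.mem_image, Finset.mem_Iio]
    constructor
    · rintro ⟨hk, hck⟩
      obtain ⟨i', rfl⟩ := (hc k).1 hck
      exact ⟨i', hf.lt_iff_lt.1 hk, rfl⟩
    · rintro ⟨i', hi', rfl⟩
      exact ⟨hf hi', (hc _).2 ⟨i', rfl⟩⟩
  rw [h, Finset.card_image_of_injective _ hf.injective, Fin.card_Iio]

/-- **WORD LEMMA.** For a linear extension `σ`, the letter of the product word `u ++ v` (as a
function on the two blocks) at the coordinate `x` is the letter of the interleaving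
`fill_{c(σ)}(u, v)` at the slot `P_σ x`. -/
theorem soloInformed_shWord_eq_fillC {σ : Equiv.Perm (Fin (p + 2 + (q + 2)))}
    (hσ : soloInformedCompat (soloInformedShPoset p q) σ) (u v : List Bool)
    (x : Fin (p + 2 + (q + 2))) :
    Fin.append (fun i : Fin (p + 2) => u.getD i false) (fun j : Fin (q + 2) => v.getD j false) x =
      soloInformedFillC (soloInformedShColour σ) u v (soloInformedCellPerm σ x) := by
  obtain ⟨h1, h2⟩ := soloInformed_shCompat_iff.1 hσ
  induction x using Fin.addCases with
  | left i =>
    rw [Fin.append_left, soloInformedFillC, if_pos (soloInformed_shColour_cellPerm_castAdd σ i),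
      soloInformed_idxC_of_strictMono _ h1 (soloInformed_shColour_eq_true_iff σ) i]
  | right j =>
    have hf : ¬ soloInformedShColour σ (soloInformedCellPerm σ (Fin.natAdd (p + 2) j)) = true := by
      rw [soloInformed_shColour_cellPerm_natAdd]
      exact Bool.false_ne_true
    rw [Fin.append_right, soloInformedFillC, if_neg hf,
      soloInformed_idxC_of_strictMono (fun k => !soloInformedShColour σ k) h2
        (fun k => by simpa using soloInformed_shColour_eq_false_iff σ k) j]

/-! ## 4. The linear extension of a colouring -/

section Inverse

variable (c : Fin (p + 2 + (q + 2)) → Bool) (hc : soloInformedCountC c = p + 2)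

/-- The complementary count. -/
theorem soloInformed_countC_not_of (hc : soloInformedCountC c = p + 2) :
    soloInformedCountC (fun k => !c k) = q + 2 := by
  have h := soloInformed_countC_add_countC_not c
  omega

/-- The slot map of a colouring: the `i`-th coordinate of the first block goes to the `i`-th
`true` slot, the `j`-th coordinate of the second block to the `j`-th `false` slot. -/
def soloInformedColTau (hc : soloInformedCountC c = p + 2) :
    Fin (p + 2 + (q + 2)) → Fin (p + 2 + (q + 2)) :=
  Fin.append (fun i => (Finset.univ.filter fun k => c k = true).orderEmbOfFin hc i)
    (fun j => (Finset.univ.filter fun k => (!c k) = true).orderEmbOfFin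
      (soloInformed_countC_not_of c hc) j)

/-- First-block coordinates land on `true` slots. -/
theorem soloInformed_colTau_castAdd (i : Fin (p + 2)) :
    c (soloInformedColTau c hc (Fin.castAdd (q + 2) i)) = true := by
  have h := Finset.orderEmbOfFin_mem (Finset.univ.filter fun k => c k = true) hc i
  rw [Finset.mem_filter] at h
  simp only [soloInformedColTau, Fin.append_left]
  exact h.2

/-- Second-block coordinates land on `false` slots. -/
theorem soloInformed_colTau_natAdd (j : Fin (q + 2)) :
    c (soloInformedColTau c hc (Fin.natAdd (p + 2) j)) = false := by
  have h := Finset.orderEmbOfFin_mem (Finset.univ.filter fun k => (!c k) = true)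
    (soloInformed_countC_not_of c hc) j
  rw [Finset.mem_filter] at h
  simp only [soloInformedColTau, Fin.append_right]
  simpa using h.2

/-- The slot map is increasing on the first block … -/
theorem soloInformed_colTau_strictMono_left :
    StrictMono fun i : Fin (p + 2) => soloInformedColTau c hc (Fin.castAdd (q + 2) i) := by
  intro i j hij
  simp only [soloInformedColTau, Fin.append_left]
  exact (Finset.orderEmbOfFin _ hc).strictMono hij

/-- … and on the second block. -/
theorem soloInformed_colTau_strictMono_right :
    StrictMono fun j : Fin (q + 2) => soloInformedColTau c hc (Fin.natAdd (p + 2) j) := by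
  intro i j hij
  simp only [soloInformedColTau, Fin.append_right]
  exact (Finset.orderEmbOfFin _ _).strictMono hij

/-- The slot map is injective. -/
theorem soloInformed_colTau_injective : Function.Injective (soloInformedColTau c hc) := by
  intro x y hxy
  induction x using Fin.addCases with
  | left i =>
    induction y using Fin.addCases with
    | left i' =>
      exact congrArg (Fin.castAdd (q + 2)) ((soloInformed_colTau_strictMono_left c hc).injective hxy)
    | right j' =>
      have h1 := soloInformed_colTau_castAdd c hc i
      rw [hxy, soloInformed_colTau_natAdd c hc] at h1
      exact absurd h1 Bool.false_ne_true
  | right j =>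
    induction y using Fin.addCases with
    | left i' =>
      have h1 := soloInformed_colTau_castAdd c hc i'
      rw [← hxy, soloInformed_colTau_natAdd c hc] at h1
      exact absurd h1 Bool.false_ne_true
    | right j' =>
      exact congrArg (Fin.natAdd (p + 2)) ((soloInformed_colTau_strictMono_right c hc).injective hxy)

/-- The slot map of a colouring as a permutation. -/
def soloInformedColPerm (hc : soloInformedCountC c = p + 2) : Equiv.Perm (Fin (p + 2 + (q + 2))) :=
  Equiv.ofBijective (soloInformedColTau c hc)
    (Finite.injective_iff_bijective.1 (soloInformed_colTau_injective c hc))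

/-- The permutation acts as the slot map. -/
@[simp] theorem soloInformed_colPerm_apply (x : Fin (p + 2 + (q + 2))) :
    soloInformedColPerm c hc x = soloInformedColTau c hc x := rfl

/-- **The linear extension of a colouring**: the permutation whose slot map is `soloInformedColTau`. -/
def soloInformedColSigma (hc : soloInformedCountC c = p + 2) : Equiv.Perm (Fin (p + 2 + (q + 2))) :=
  Fin.revPerm.trans (soloInformedColPerm c hc).symm

/-- Its slot map is the slot map of the colouring. -/
theorem soloInformed_cellPerm_colSigma_apply (x : Fin (p + 2 + (q + 2))) :
    soloInformedCellPerm (soloInformedColSigma c hc) x = soloInformedColTau c hc x := by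
  simp [soloInformedCellPerm, soloInformedColSigma]

/-- It is a linear extension of the two chains. -/
theorem soloInformed_colSigma_compat :
    soloInformedCompat (soloInformedShPoset p q) (soloInformedColSigma c hc) := by
  rw [soloInformed_shCompat_iff]
  simp only [soloInformed_cellPerm_colSigma_apply]
  exact ⟨soloInformed_colTau_strictMono_left c hc, soloInformed_colTau_strictMono_right c hc⟩

/-- Its colouring is `c`. -/
theorem soloInformed_shColour_colSigma : soloInformedShColour (soloInformedColSigma c hc) = c := by
  funext k
  obtain ⟨x, rfl⟩ : ∃ x, k = soloInformedCellPerm (soloInformedColSigma c hc) x :=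
    ⟨(soloInformedCellPerm (soloInformedColSigma c hc)).symm k, (Equiv.apply_symm_apply _ k).symm⟩
  induction x using Fin.addCases with
  | left i =>
    rw [soloInformed_shColour_cellPerm_castAdd, soloInformed_cellPerm_colSigma_apply,
      soloInformed_colTau_castAdd c hc]
  | right j =>
    rw [soloInformed_shColour_cellPerm_natAdd, soloInformed_cellPerm_colSigma_apply,
      soloInformed_colTau_natAdd c hc]

end Inverse

/-- **A linear extension is determined by its colouring.** -/
theorem soloInformed_eq_colSigma {σ : Equiv.Perm (Fin (p + 2 + (q + 2)))}
    (hσ : soloInformedCompat (soloInformedShPoset p q) σ)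
    (hc : soloInformedCountC (soloInformedShColour σ) = p + 2) :
    σ = soloInformedColSigma (soloInformedShColour σ) hc := by
  obtain ⟨h1, h2⟩ := soloInformed_shCompat_iff.1 hσ
  have key : soloInformedCellPerm σ = soloInformedColPerm (soloInformedShColour σ) hc := by
    refine Equiv.ext fun x => ?_
    rw [soloInformed_colPerm_apply]
    induction x using Fin.addCases with
    | left i =>
      have hu := Finset.orderEmbOfFin_unique hc
        (f := fun i : Fin (p + 2) => soloInformedCellPerm σ (Fin.castAdd (q + 2) i))
        (fun i => Finset.mem_filter.2 ⟨Finset.mem_univ _, soloInformed_shColour_cellPerm_castAdd σ i⟩)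
        h1
      simp only [soloInformedColTau, Fin.append_left]
      exact congrFun hu i
    | right j =>
      have hu := Finset.orderEmbOfFin_unique (soloInformed_countC_not_of _ hc)
        (f := fun j : Fin (q + 2) => soloInformedCellPerm σ (Fin.natAdd (p + 2) j))
        (fun j => Finset.mem_filter.2
          ⟨Finset.mem_univ _, by simpa using soloInformed_shColour_cellPerm_natAdd σ j⟩)
        h2
      simp only [soloInformedColTau, Fin.append_right]
      exact congrFun hu j
  calc σ = Fin.revPerm.trans (soloInformedCellPerm σ).symm :=
        soloInformed_eq_revPerm_trans_cellPerm_symm σ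
    _ = Fin.revPerm.trans (soloInformedColPerm (soloInformedShColour σ) hc).symm := by rw [key]
    _ = soloInformedColSigma (soloInformedShColour σ) hc := rfl

/-! ## 5. Sums over linear extensions are sums over colourings -/

/-- **Re-indexing by colourings.** For any `G`,
`∑_{σ ⊨ E} G (c(σ)) = ∑_{c : #c⁻¹(true) = p+2} G c`. -/
theorem soloInformed_sum_shCompat_eq_sum_colouring {M : Type*} [AddCommMonoid M]
    (G : (Fin (p + 2 + (q + 2)) → Bool) → M) :
    ∑ σ ∈ Finset.univ.filter (soloInformedCompat (soloInformedShPoset p q)),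
        G (soloInformedShColour σ) =
      ∑ c : Fin (p + 2 + (q + 2)) → Bool,
        if soloInformedCountC c = p + 2 then G c else 0 := by
  rw [← Finset.sum_filter]
  refine Finset.sum_nbij' (fun σ => soloInformedShColour σ)
    (fun c => if hc : soloInformedCountC c = p + 2 then soloInformedColSigma c hc else 1)
    (fun σ _ => ?_) (fun c hcm => ?_) (fun σ hσ => ?_) (fun c hcm => ?_) fun _ _ => rfl
  · exact Finset.mem_filter.2 ⟨Finset.mem_univ _, soloInformed_countC_shColour σ⟩
  · have hc := (Finset.mem_filter.1 hcm).2
    rw [dif_pos hc]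
    exact Finset.mem_filter.2 ⟨Finset.mem_univ _, soloInformed_colSigma_compat c hc⟩
  · rw [dif_pos (soloInformed_countC_shColour σ)]
    exact (soloInformed_eq_colSigma (Finset.mem_filter.1 hσ).2 _).symm
  · have hc := (Finset.mem_filter.1 hcm).2
    rw [dif_pos hc]
    exact soloInformed_shColour_colSigma c hc

end Summit.KontsevichZagierPeriods.KontsevichZagierPeriods.Theorems
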